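/-
Origin: expansion seat `planner-pub-hodgecm-pv10-0`, handover 2026-08-18 (`HOME/pub-hodgecm-pv10/lean/Pv10/ClassNormProper.lean`, md5 2fc081af, 202 lines);
landed by the gen-6 packager in gate run 22 as `HodgeCM/PerL34/ClassNormProper.lean` (import ^import Pv[0-9]+\.→import HodgeCM.PerL34. ×2).
-/
/-
# `C¹_K` compact ⇒ the (log) class norm `C_K → ℝ` is a proper map (N15, tex l. 311)

WIP module `Pv10.ClassNormProper` (pub-hodgecm-pv10); intended landing
`HodgeCM/PerL34/ClassNormProper.lean`.

PerL v5 §3.2, tex ll. 310–311 (node N15): "`ι` ... injects continuously and properly: norm-one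
classes are compact and `|·|_L = |·|²_{L₀}`".  The inference "C¹ compact ⇒ the norm is proper" is
made KERNEL here, over Mathlib's adeles:

* `realToCompletion K v : ℝ →+* v.Completion` — the canonical copy of `ℝ` in `K_v` (inverse of
  Mathlib's `ringEquivRealOfIsReal` / `ringEquivComplexOfIsComplex ∘ ofReal`), an isometry;
* `expLine K : ℝ → (InfiniteAdeleRing K)ˣ`, `s ↦ (e^s, …, e^s)`, continuous, of idele norm
  `e^{[K:ℚ]·s}` (`ideleNorm_expLine`);
* `logClassNorm K : IdeleClassGroup K → ℝ`, `c ↦ log |c|`, continuous and additive;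
* **`isProperMap_logClassNorm`**: IF `C¹_K` is compact (the typed PRINT target
  `NormOneIdeleClassesCompact K` of `IdeleNorm.lean`: Cassels–Fröhlich Ch. II §16, PDF p. 121;
  Neukirch VI (1.6), PDF p. 323) THEN `logClassNorm K` is a proper map — every class is
  `[expLine (log|c| / [K:ℚ])] · c₁` with `c₁ ∈ C¹_K`, so the preimage of `[a, b]` is a closed subset of
  the compact set `[expLine [a/n, b/n]] · C¹_K`.

Feeding `ProperCriterion.isProperMap_of_comp_factor` (f := ι, NA := logClassNorm L₀, g := ½·logClassNorm L)
then gives "ι proper" from `log|ι x|_L = 2 log|x|_{L₀}` — the base-change identity itself is INPUT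
(no adelic base change in Mathlib).  No PerL/QW8/2001 statement is used.
-/
import Summits.HodgeConjecture.HodgeCM.PerL34.IdeleNorm
import Summits.HodgeConjecture.HodgeCM.PerL34.PolarDecomposition
import Mathlib.Topology.Maps.Proper.CompactlyGenerated
import Mathlib.Analysis.SpecialFunctions.Log.Basic

set_option autoImplicit false

noncomputable section

open Topology Filter Set Function

namespace NumberField

open InfinitePlace NumberField.InfinitePlace.Completion InfiniteAdeleRing

variable (K : Type*) [Field K] [NumberField K]

/-! ## The canonical copy of `ℝ` in each `K_v` -/

open scoped Classical in
/-- `ℝ →+* K_v`: the inverse of `K_v ≃ ℝ` at a real place, `ℝ ⊂ ℂ ≃ K_v` at a complex place. -/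
def realToCompletion (v : InfinitePlace K) : ℝ →+* v.Completion :=
  if hv : IsReal v then (ringEquivRealOfIsReal hv).symm.toRingHom
  else ((ringEquivComplexOfIsComplex (not_isReal_iff_isComplex.mp hv)).symm.toRingHom).comp
    Complex.ofRealHom

omit [NumberField K] in
/-- (Ported verbatim from the HodgeCMPerL package; no docstring in the source.) -/
theorem extensionEmbedding_realToCompletion (v : InfinitePlace K) (r : ℝ) :
    extensionEmbedding v (realToCompletion K v r) = (r : ℂ) := by
  unfold realToCompletion
  split_ifs with hv
  · rw [RingEquiv.toRingHom_eq_coe, RingHom.coe_coe, ← extensionEmbeddingOfIsReal_apply hv,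
      ← ringEquivRealOfIsReal_apply hv, RingEquiv.apply_symm_apply]
  · rw [RingHom.comp_apply, RingEquiv.toRingHom_eq_coe, RingHom.coe_coe,
      ← ringEquivComplexOfIsComplex_apply (not_isReal_iff_isComplex.mp hv), RingEquiv.apply_symm_apply]
    rfl

omit [NumberField K] in
/-- (Ported verbatim from the HodgeCMPerL package; no docstring in the source.) -/
theorem norm_realToCompletion (v : InfinitePlace K) (r : ℝ) : ‖realToCompletion K v r‖ = ‖r‖ := by
  rw [← norm_extensionEmbedding K v, extensionEmbedding_realToCompletion, Complex.norm_real]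

omit [NumberField K] in
/-- (Ported verbatim from the HodgeCMPerL package; no docstring in the source.) -/
theorem isometry_realToCompletion (v : InfinitePlace K) : Isometry (realToCompletion K v) :=
  AddMonoidHomClass.isometry_of_norm _ (norm_realToCompletion K v)

omit [NumberField K] in
/-- (Ported verbatim from the HodgeCMPerL package; no docstring in the source.) -/
theorem continuous_realToCompletion (v : InfinitePlace K) : Continuous (realToCompletion K v) :=
  (isometry_realToCompletion K v).continuous

/-! ## The one-parameter group `s ↦ (e^s, …, e^s)` in `K_∞^×` -/

/-- `expLine s = (e^s)_v ∈ K_∞^×`. -/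
def expLine (s : ℝ) : (InfiniteAdeleRing K)ˣ where
  val := fun v => realToCompletion K v (Real.exp s)
  inv := fun v => realToCompletion K v (Real.exp (-s))
  val_inv := by
    funext v
    show realToCompletion K v (Real.exp s) * realToCompletion K v (Real.exp (-s)) = 1
    rw [← map_mul, ← Real.exp_add, add_neg_cancel, Real.exp_zero, map_one]
  inv_val := by
    funext v
    show realToCompletion K v (Real.exp (-s)) * realToCompletion K v (Real.exp s) = 1
    rw [← map_mul, ← Real.exp_add, neg_add_cancel, Real.exp_zero, map_one]

omit [NumberField K] in
/-- (Ported verbatim from the HodgeCMPerL package; no docstring in the source.) -/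
theorem expLine_apply (s : ℝ) (v : InfinitePlace K) :
    (expLine K s : InfiniteAdeleRing K) v = realToCompletion K v (Real.exp s) := rfl

omit [NumberField K] in
/-- (Ported verbatim from the HodgeCMPerL package; no docstring in the source.) -/
theorem continuous_expLine : Continuous (expLine K) := by
  refine Units.continuous_iff.mpr ⟨?_, ?_⟩
  · exact continuous_pi fun v => (continuous_realToCompletion K v).comp Real.continuous_exp
  · exact continuous_pi fun v =>
      (continuous_realToCompletion K v).comp (Real.continuous_exp.comp continuous_neg)

omit [NumberField K] in
/-- (Ported verbatim from the HodgeCMPerL package; no docstring in the source.) -/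
theorem expLine_mem_posRealUnits (s : ℝ) : expLine K s ∈ posRealUnits K := fun v =>
  ⟨Real.exp s, Real.exp_pos s, by rw [expLine_apply, extensionEmbedding_realToCompletion]⟩

/-- (Ported verbatim from the HodgeCMPerL package; no docstring in the source.) -/
theorem norm_expLine (s : ℝ) :
    ‖(expLine K s : InfiniteAdeleRing K)‖ = Real.exp ((Module.finrank ℚ K : ℝ) * s) := by
  rw [norm_def]
  simp only [expLine_apply, norm_realToCompletion, Real.norm_eq_abs, Real.abs_exp]
  rw [Finset.prod_pow_eq_pow_sum, sum_mult_eq, Real.exp_nat_mul]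

/-- (Ported verbatim from the HodgeCMPerL package; no docstring in the source.) -/
theorem ideleNorm_expLine (s : ℝ) :
    ideleNorm K (infUnitsToIdele K (expLine K s)) = Real.exp ((Module.finrank ℚ K : ℝ) * s) := by
  rw [ideleNorm_infUnitsToIdele, norm_expLine]

/-- The class of `expLine s` in `C_K`. -/
def expClass (s : ℝ) : IdeleClassGroup K := infUnitsToClass K (expLine K s)

/-- (Ported verbatim from the HodgeCMPerL package; no docstring in the source.) -/
theorem continuous_expClass : Continuous (expClass K) :=
  (continuous_infUnitsToClass K).comp (continuous_expLine K)

/-- (Ported verbatim from the HodgeCMPerL package; no docstring in the source.) -/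
theorem coe_classNorm_expClass (s : ℝ) :
    (classNorm K (expClass K s) : ℝ) = Real.exp ((Module.finrank ℚ K : ℝ) * s) := by
  rw [expClass, show infUnitsToClass K (expLine K s) = QuotientGroup.mk (infUnitsToIdele K (expLine K s))
    from rfl, classNorm_mk, coe_ideleNormUnits, ideleNorm_expLine]

/-- (Ported verbatim from the HodgeCMPerL package; no docstring in the source.) -/
theorem expClass_mem_range_posRealToClass (s : ℝ) : expClass K s ∈ (posRealToClass K).range :=
  ⟨⟨expLine K s, expLine_mem_posRealUnits K s⟩, rfl⟩

/-! ## The logarithmic class norm -/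

/-- `log |·| : C_K → ℝ`. -/
def logClassNorm (c : IdeleClassGroup K) : ℝ := Real.log (classNorm K c : ℝ)

/-- (Ported verbatim from the HodgeCMPerL package; no docstring in the source.) -/
theorem continuous_logClassNorm : Continuous (logClassNorm K) :=
  (Units.continuous_val.comp (continuous_classNorm K)).log fun c => (coe_classNorm_pos K c).ne'

/-- (Ported verbatim from the HodgeCMPerL package; no docstring in the source.) -/
theorem logClassNorm_mul (c c' : IdeleClassGroup K) :
    logClassNorm K (c * c') = logClassNorm K c + logClassNorm K c' := by
  simp only [logClassNorm, map_mul, Units.val_mul]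
  exact Real.log_mul (coe_classNorm_pos K c).ne' (coe_classNorm_pos K c').ne'

/-- (Ported verbatim from the HodgeCMPerL package; no docstring in the source.) -/
theorem logClassNorm_expClass (s : ℝ) :
    logClassNorm K (expClass K s) = (Module.finrank ℚ K : ℝ) * s := by
  rw [logClassNorm, coe_classNorm_expClass, Real.log_exp]

/-- (Ported verbatim from the HodgeCMPerL package; no docstring in the source.) -/
theorem logClassNorm_eq_zero_iff (c : IdeleClassGroup K) :
    logClassNorm K c = 0 ↔ c ∈ normOneIdeleClasses K := by
  rw [mem_normOneIdeleClasses_iff, logClassNorm]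
  constructor
  · intro h
    exact Real.eq_one_of_pos_of_log_eq_zero (coe_classNorm_pos K c) h
  · intro h
    rw [h, Real.log_one]

/-- Every class is `expClass (log|c|/n) · c₁` with `c₁ ∈ C¹_K`. -/
theorem exists_expClass_mul_normOne (c : IdeleClassGroup K) :
    ∃ c₁ ∈ normOneIdeleClasses K,
      c = expClass K (logClassNorm K c / (Module.finrank ℚ K : ℝ)) * c₁ := by
  have hn : (Module.finrank ℚ K : ℝ) ≠ 0 := by
    exact_mod_cast (Module.finrank_pos (R := ℚ) (M := K)).ne'
  refine ⟨(expClass K (logClassNorm K c / (Module.finrank ℚ K : ℝ)))⁻¹ * c, ?_,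
    by rw [mul_inv_cancel_left]⟩
  rw [← logClassNorm_eq_zero_iff]
  have h := logClassNorm_mul K (expClass K (logClassNorm K c / (Module.finrank ℚ K : ℝ)))
    ((expClass K (logClassNorm K c / (Module.finrank ℚ K : ℝ)))⁻¹ * c)
  rw [mul_inv_cancel_left, logClassNorm_expClass, mul_div_cancel₀ _ hn] at h
  linarith

/-! ## Properness -/

/-- **`C¹_K` compact ⇒ `log|·| : C_K → ℝ` is proper** (PerL l. 311: "norm-one classes are compact"
⇒ the norm is proper; then "`|·|_L = |·|²_{L₀}`" ⇒ `ι` proper by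
`ProperCriterion.isProperMap_of_comp_factor`). -/
theorem isProperMap_logClassNorm (h : NormOneIdeleClassesCompact K) :
    IsProperMap (logClassNorm K) := by
  set n : ℝ := (Module.finrank ℚ K : ℝ) with hn_def
  have hn : 0 < n := by
    rw [hn_def]; exact_mod_cast (Module.finrank_pos (R := ℚ) (M := K))
  refine isProperMap_iff_isCompact_preimage.mpr ⟨continuous_logClassNorm K, fun S hS => ?_⟩
  obtain ⟨a, ha⟩ := hS.bddBelow
  obtain ⟨b, hb⟩ := hS.bddAbove
  -- the compact set `expClass [a/n, b/n] · C¹_K`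
  set T : Set (IdeleClassGroup K) :=
    (fun p : ℝ × IdeleClassGroup K => expClass K p.1 * p.2) ''
      (Set.Icc (a / n) (b / n) ×ˢ (normOneIdeleClasses K : Set (IdeleClassGroup K))) with hT_def
  have hT : IsCompact T :=
    (isCompact_Icc.prod h).image (((continuous_expClass K).comp continuous_fst).mul continuous_snd)
  refine hT.of_isClosed_subset (hS.isClosed.preimage (continuous_logClassNorm K)) fun c hc => ?_
  obtain ⟨c₁, hc₁, hcc⟩ := exists_expClass_mul_normOne K c
  refine ⟨(logClassNorm K c / n, c₁), ⟨⟨?_, ?_⟩, hc₁⟩, hcc.symm⟩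
  · exact div_le_div_of_nonneg_right (ha hc) hn.le
  · exact div_le_div_of_nonneg_right (hb hc) hn.le

/-- The fibres version: `C¹_K` compact ⇒ `{c : |c| ∈ [e^a, e^b]}`-type sets are compact; in particular
the preimage of any compact set of reals under `log|·|` is compact. -/
theorem isCompact_preimage_logClassNorm (h : NormOneIdeleClassesCompact K) {S : Set ℝ}
    (hS : IsCompact S) : IsCompact (logClassNorm K ⁻¹' S) :=
  (isProperMap_logClassNorm K h).isCompact_preimage hS

end NumberField

end
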